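import Mathlib.MeasureTheory.Measure.Lebesgue.Complex
import Mathlib.MeasureTheory.Integral.Prod
import Mathlib.MeasureTheory.Function.L2Space
import Mathlib.MeasureTheory.Integral.IntervalIntegral.FundThmCalculus
import Mathlib.Analysis.Complex.ReImTopology
import Mathlib.Analysis.Calculus.ContDiff.RCLike
import Mathlib.Analysis.Complex.RealDeriv
import Mathlib.Topology.Order.ExtendFrom
import HarnessLib

/-!
# The length–area inequality on a rectangle

Topic `Literature/Probability/RandomPlanarGeometry`; the elementary half of the Dirichlet
principle for the conformal modulus of a quadrilateral, used by the variational proof of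
`ShearCrossRatioAnalytic` (`ShearModulusAnalytic.lean`). Everything here is PROVED.

**Length–area lemma** (Grötzsch; Ahlfors, *Lectures on Quasiconformal Mappings* (1966), Ch. I §A;
Lehto–Virtanen (1973), Ch. I §4.3). Let `U` be continuously differentiable on the open rectangle
`(-a, a) × (0, h)` with `∫ U_ξ² < ∞`, and suppose that on every horizontal line `η = const`
(`0 < η < h`) `U` tends to `c₀` at the left side and to `c₁` at the right side. Then
`(c₁ - c₀)² · h / (2a) ≤ ∫ U_ξ²` (`sq_mul_div_le_integral_sq_deriv`): on almost every line
`∫ U_ξ dξ = c₁ - c₀` (fundamental theorem of calculus for the extension of `U` to the closed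
segment) and `(∫ U_ξ)² ≤ 2a ∫ U_ξ²` (Cauchy–Schwarz); integrate in `η` (Fubini). With the
affine function `(ξ + a)/(2a)` this shows that the minimal Dirichlet energy of the rectangle with
boundary values `0, 1` on the vertical sides is `h/(2a)`.

## Mathlib

USED: `Complex.volume_preserving_equiv_real_prod`, `MeasureTheory.setIntegral_prod`,
`Integrable.prod_right_ae`, `Integrable.integral_prod_left`, `memLp_two_iff_integrable_sq`,
`continuousOn_Icc_extendFrom_Ioo`, `intervalIntegral.integral_eq_sub_of_hasDerivAt_of_le`.

## References

* L. V. Ahlfors, *Lectures on Quasiconformal Mappings*, Van Nostrand (1966), Ch. I §A–§C.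
* O. Lehto, K. I. Virtanen, *Quasiconformal Mappings in the Plane*, Springer (1973), Ch. I §4.
  [folklore]
-/

noncomputable section

open Set Filter MeasureTheory Complex
open scoped Topology

namespace Literature.Probability.RandomPlanarGeometry

namespace LengthArea

/-! ### Cauchy–Schwarz on an interval -/

/-- `(∫_s g)² ≤ μ(s) · ∫_s g²` for an integrable `g` with integrable square on a set of finite
measure. [folklore] -/
theorem sq_setIntegral_le {s : Set ℝ} (hs : volume s ≠ ⊤) {g : ℝ → ℝ} (hg : IntegrableOn g s)
    (hg2 : IntegrableOn (fun x => g x ^ 2) s) :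
    (∫ x in s, g x) ^ 2 ≤ (volume s).toReal * ∫ x in s, g x ^ 2 := by
  haveI : IsFiniteMeasure (volume.restrict s) := ⟨by rwa [Measure.restrict_apply_univ, lt_top_iff_ne_top]⟩
  set V : ℝ := (volume s).toReal with hV
  set J : ℝ := ∫ x in s, g x with hJ
  rcases eq_or_lt_of_le (ENNReal.toReal_nonneg : 0 ≤ V) with hV0 | hV0
  · -- measure zero: both sides vanish
    have hs0 : volume s = 0 := by
      rcases (ENNReal.toReal_eq_zero_iff _).1 hV0.symm with h | h
      · exact h
      · exact absurd h hs
    have : (∫ x in s, g x) = 0 := by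
      rw [Measure.restrict_eq_zero.2 hs0, integral_zero_measure]
    rw [hJ, this, hV, ← hV0]
    simp
  · -- expand `0 ≤ ∫ (g - J/V)²`
    have hconst : IntegrableOn (fun _ : ℝ => (1 : ℝ)) s := integrableOn_const hs
    have h0 : 0 ≤ ∫ x in s, (g x - J / V) ^ 2 := integral_nonneg fun x => sq_nonneg _
    have hexp : (fun x => (g x - J / V) ^ 2) = fun x => g x ^ 2 - (2 * (J / V)) * g x + (J / V) ^ 2 * 1 := by
      funext x; ring
    rw [hexp, MeasureTheory.integral_add, MeasureTheory.integral_sub hg2 (hg.const_mul _), integral_const_mul,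
      integral_const_mul] at h0
    · have h1 : ∫ _ in s, (1 : ℝ) = V := by
        rw [setIntegral_const, smul_eq_mul, mul_one, hV, Measure.real]
      rw [h1, ← hJ] at h0
      have hVne : V ≠ 0 := hV0.ne'
      have : J ^ 2 ≤ V * ∫ x in s, g x ^ 2 := by
        have h2 : 0 ≤ (∫ x in s, g x ^ 2) - J ^ 2 / V := by
          have : (∫ x in s, g x ^ 2) - 2 * (J / V) * J + (J / V) ^ 2 * V = (∫ x in s, g x ^ 2) - J ^ 2 / V := by
            field_simp; ring
          linarith
        rw [sub_nonneg, div_le_iff₀ hV0] at h2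
        linarith
      exact this
    · exact hg2.sub (hg.const_mul _)
    · exact hconst.const_mul _

/-! ### One line: the fundamental theorem of calculus with one-sided boundary limits -/

/-- If `V` has derivative `g` on `(α, β)`, `g` is integrable there, and `V → c₀` at `α⁺`,
`V → c₁` at `β⁻`, then `∫_{(α,β)} g = c₁ - c₀` (FTC for the continuous extension of `V` to
`[α, β]`). [folklore] -/
theorem setIntegral_deriv_eq_sub {α β c₀ c₁ : ℝ} (hαβ : α < β) {V g : ℝ → ℝ}
    (hderiv : ∀ x ∈ Ioo α β, HasDerivAt V (g x) x) (hg : IntegrableOn g (Ioo α β))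
    (h0 : Tendsto V (𝓝[>] α) (𝓝 c₀)) (h1 : Tendsto V (𝓝[<] β) (𝓝 c₁)) :
    ∫ x in Ioo α β, g x = c₁ - c₀ := by
  set W := extendFrom (Ioo α β) V with hW
  have hVc : ContinuousOn V (Ioo α β) := fun x hx => (hderiv x hx).continuousAt.continuousWithinAt
  have hWc : ContinuousOn W (Icc α β) := continuousOn_Icc_extendFrom_Ioo hVc h0 h1
  have hWα : W α = c₀ := eq_lim_at_left_extendFrom_Ioo hαβ h0
  have hWβ : W β = c₁ := eq_lim_at_right_extendFrom_Ioo hαβ h1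
  have hWeq : ∀ x ∈ Ioo α β, W x = V x := fun x hx => extendFrom_extends hVc x hx
  have hWderiv : ∀ x ∈ Ioo α β, HasDerivAt W (g x) x := by
    intro x hx
    refine (hderiv x hx).congr_of_eventuallyEq ?_
    filter_upwards [isOpen_Ioo.mem_nhds hx] with y hy
    exact hWeq y hy
  have hint : IntervalIntegrable g volume α β :=
    (intervalIntegrable_iff_integrableOn_Ioo_of_le hαβ.le).2 hg
  have h := intervalIntegral.integral_eq_sub_of_hasDerivAt_of_le hαβ.le hWc hWderiv hint
  rw [hWα, hWβ, intervalIntegral.integral_of_le hαβ.le, integral_Ioc_eq_integral_Ioo] at h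
  exact h

/-- **Length–area on one line**: under the hypotheses of `setIntegral_deriv_eq_sub` and with
`g²` integrable, `(c₁ - c₀)² ≤ (β - α) ∫_{(α,β)} g²`. [folklore] -/
theorem sq_sub_le_mul_setIntegral_sq {α β c₀ c₁ : ℝ} (hαβ : α < β) {V g : ℝ → ℝ}
    (hderiv : ∀ x ∈ Ioo α β, HasDerivAt V (g x) x) (hg : IntegrableOn g (Ioo α β))
    (hg2 : IntegrableOn (fun x => g x ^ 2) (Ioo α β))
    (h0 : Tendsto V (𝓝[>] α) (𝓝 c₀)) (h1 : Tendsto V (𝓝[<] β) (𝓝 c₁)) :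
    (c₁ - c₀) ^ 2 ≤ (β - α) * ∫ x in Ioo α β, g x ^ 2 := by
  have h := sq_setIntegral_le (s := Ioo α β) (by simp) hg hg2
  rwa [setIntegral_deriv_eq_sub hαβ hderiv hg h0 h1, Real.volume_Ioo,
    ENNReal.toReal_ofReal (by linarith)] at h

/-! ### The rectangle: slices and Fubini -/

/-- The measurable equivalence `(η, ξ) ↦ ξ + iη` from `ℝ × ℝ` to `ℂ` (vertical coordinate
FIRST, so that Fubini puts the integral along horizontal lines inside). [folklore] -/
theorem measurePreserving_sliceEquiv :
    MeasurePreserving (MeasurableEquiv.prodComm.trans measurableEquivRealProd.symm :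
      ℝ × ℝ ≃ᵐ ℂ) := by
  have h1 : MeasurePreserving (MeasurableEquiv.prodComm : ℝ × ℝ ≃ᵐ ℝ × ℝ) :=
    (Measure.measurePreserving_swap (μ := (volume : Measure ℝ)) (ν := (volume : Measure ℝ)))
  exact volume_preserving_equiv_real_prod.symm.comp h1

/-- The slice equivalence in coordinates: `(η, ξ) ↦ ξ + η i`. [folklore] -/
theorem sliceEquiv_apply (p : ℝ × ℝ) :
    (MeasurableEquiv.prodComm.trans measurableEquivRealProd.symm : ℝ × ℝ ≃ᵐ ℂ) p =
      (p.2 : ℂ) + p.1 * I := by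
  change (⟨p.2, p.1⟩ : ℂ) = _
  exact mk_eq_add_mul_I _ _

/-- The slice equivalence pulls the rectangle `(-a, a) × (0, h)` back to `(0, h) ×ˢ (-a, a)`.
[folklore] -/
theorem sliceEquiv_preimage (a h : ℝ) :
    (MeasurableEquiv.prodComm.trans measurableEquivRealProd.symm : ℝ × ℝ ≃ᵐ ℂ) ⁻¹'
      (Ioo (-a) a ×ℂ Ioo 0 h) = Ioo 0 h ×ˢ Ioo (-a) a := by
  ext p
  rw [mem_preimage, sliceEquiv_apply, mem_reProdIm, mem_prod]
  simp only [add_re, ofReal_re, mul_re, I_re, mul_zero, ofReal_im, I_im, mul_one, sub_self,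
    add_zero, add_im, mul_im, zero_add]
  exact and_comm

/-- Derivative along a horizontal line: `ξ ↦ U (ξ + iη)` has derivative `fderiv U (ξ + iη) 1`.
[folklore] -/
theorem hasDerivAt_slice {U : ℂ → ℝ} {w : ℂ} (hU : DifferentiableAt ℝ U w) :
    HasDerivAt (fun ξ : ℝ => U ((ξ : ℂ) + w.im * I)) (fderiv ℝ U w 1) w.re := by
  have hp : HasDerivAt (fun ξ : ℝ => ((ξ : ℝ) : ℂ) + w.im * I) 1 w.re := by
    have h := ((hasDerivAt_id (w.re)).ofReal_comp).add_const ((w.im : ℂ) * I)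
    simpa using h
  have hw : ((w.re : ℝ) : ℂ) + w.im * I = w := re_add_im w
  have hU' : HasFDerivAt U (fderiv ℝ U w) (((w.re : ℝ) : ℂ) + w.im * I) := by
    rw [hw]; exact hU.hasFDerivAt
  exact hU'.comp_hasDerivAt w.re hp

/-- **The length–area inequality on a rectangle.** Let `U` be `C¹` on the open rectangle
`(-a, a) × (0, h)` with `∫ U_ξ² < ∞` (`U_ξ = fderiv U · 1`), tending on every horizontal line
`im = η`, `0 < η < h`, to `c₀` at the left side and to `c₁` at the right side. Then
`(c₁ - c₀)² · h / (2a) ≤ ∫ U_ξ²` over the rectangle. (Grötzsch's length–area argument;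
Ahlfors (1966), Ch. I §A; Lehto–Virtanen (1973), Ch. I §4.3.) [folklore] -/
theorem sq_mul_div_le_setIntegral {a h : ℝ} (ha : 0 < a) (hh : 0 < h) {U : ℂ → ℝ} {c₀ c₁ : ℝ}
    (hU : ContDiffOn ℝ 1 U (Ioo (-a) a ×ℂ Ioo 0 h))
    (hint : IntegrableOn (fun w => (fderiv ℝ U w 1) ^ 2) (Ioo (-a) a ×ℂ Ioo 0 h))
    (h0 : ∀ η ∈ Ioo 0 h, Tendsto (fun ξ : ℝ => U ((ξ : ℂ) + η * I)) (𝓝[>] (-a)) (𝓝 c₀))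
    (h1 : ∀ η ∈ Ioo 0 h, Tendsto (fun ξ : ℝ => U ((ξ : ℂ) + η * I)) (𝓝[<] a) (𝓝 c₁)) :
    (c₁ - c₀) ^ 2 * h / (2 * a) ≤ ∫ w in (Ioo (-a) a ×ℂ Ioo 0 h), (fderiv ℝ U w 1) ^ 2 := by
  set R : Set ℂ := Ioo (-a) a ×ℂ Ioo 0 h with hR
  set G : ℂ → ℝ := fun w => fderiv ℝ U w 1 with hG
  set e : ℝ × ℝ ≃ᵐ ℂ := MeasurableEquiv.prodComm.trans measurableEquivRealProd.symm with he
  have hRo : IsOpen R := isOpen_Ioo.reProdIm isOpen_Ioo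
  have hmp : MeasurePreserving e := measurePreserving_sliceEquiv
  have hemb : MeasurableEmbedding e := e.measurableEmbedding
  have hpre : e ⁻¹' R = Ioo 0 h ×ˢ Ioo (-a) a := sliceEquiv_preimage a h
  -- continuity of the partial derivative
  have hGc : ContinuousOn G R := by
    have h1 : ContinuousOn (fderiv ℝ U) R := hU.continuousOn_fderiv_of_isOpen hRo le_rfl
    exact (ContinuousLinearMap.apply ℝ ℝ (1 : ℂ)).continuous.comp_continuousOn h1
  -- Fubini: the energy as an iterated integral, lines inside
  have hint' : IntegrableOn (fun p => G (e p) ^ 2) (Ioo 0 h ×ˢ Ioo (-a) a) := by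
    rw [← hpre]
    exact (hmp.integrableOn_comp_preimage hemb).2 hint
  have hFub : ∫ w in R, G w ^ 2 = ∫ η in Ioo 0 h, ∫ ξ in Ioo (-a) a, G (e (η, ξ)) ^ 2 := by
    rw [← hmp.setIntegral_preimage_emb hemb (fun w => G w ^ 2) R, hpre]
    exact setIntegral_prod (fun p => G (e p) ^ 2) hint'
  have hprod : Integrable (fun p : ℝ × ℝ => G (e p) ^ 2)
      ((volume.restrict (Ioo 0 h)).prod (volume.restrict (Ioo (-a) a))) := by
    rw [Measure.prod_restrict]; exact hint'
  -- almost every line carries an integrable slice of `U_ξ²`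
  have hae : ∀ᵐ η ∂(volume.restrict (Ioo 0 h)),
      (c₁ - c₀) ^ 2 / (2 * a) ≤ ∫ ξ in Ioo (-a) a, G (e (η, ξ)) ^ 2 := by
    filter_upwards [hprod.prod_right_ae, ae_restrict_mem measurableSet_Ioo] with η hη hηmem
    have heq : ∀ ξ : ℝ, e (η, ξ) = (ξ : ℂ) + η * I := fun ξ => sliceEquiv_apply (η, ξ)
    simp only [heq] at hη ⊢
    -- the slice `ξ ↦ G (ξ + iη)` is continuous on `(-a, a)`, square integrable, hence integrable
    have hmem : ∀ ξ ∈ Ioo (-a) a, ((ξ : ℂ) + η * I) ∈ R := fun ξ hξ =>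
      ⟨by simpa using hξ, by simpa using hηmem⟩
    have hcont : ContinuousOn (fun ξ : ℝ => G ((ξ : ℂ) + η * I)) (Ioo (-a) a) :=
      hGc.comp (by fun_prop) hmem
    have hmeas : AEStronglyMeasurable (fun ξ : ℝ => G ((ξ : ℂ) + η * I))
        (volume.restrict (Ioo (-a) a)) := hcont.aestronglyMeasurable measurableSet_Ioo
    have hL2 : MemLp (fun ξ : ℝ => G ((ξ : ℂ) + η * I)) 2 (volume.restrict (Ioo (-a) a)) :=
      (memLp_two_iff_integrable_sq hmeas).2 hη
    have hL1 : IntegrableOn (fun ξ : ℝ => G ((ξ : ℂ) + η * I)) (Ioo (-a) a) :=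
      hL2.integrable one_le_two
    have hderiv : ∀ ξ ∈ Ioo (-a) a,
        HasDerivAt (fun ξ : ℝ => U ((ξ : ℂ) + η * I)) (G ((ξ : ℂ) + η * I)) ξ := by
      intro ξ hξ
      have hd : DifferentiableAt ℝ U ((ξ : ℂ) + η * I) :=
        (hU.differentiableOn one_ne_zero).differentiableAt (hRo.mem_nhds (hmem ξ hξ))
      have h := hasDerivAt_slice hd
      simp only [add_re, ofReal_re, mul_re, I_re, mul_zero, ofReal_im, I_im, mul_one, sub_self,
        add_zero, add_im, mul_im, zero_add] at h
      exact h
    have h := sq_sub_le_mul_setIntegral_sq (by linarith : -a < a) hderiv hL1 hη (h0 η hηmem)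
      (h1 η hηmem)
    rw [div_le_iff₀ (by linarith : (0:ℝ) < 2 * a)]
    linarith
  -- integrate over `η ∈ (0, h)`
  have hI : Integrable (fun η => ∫ ξ in Ioo (-a) a, G (e (η, ξ)) ^ 2) (volume.restrict (Ioo 0 h)) :=
    hprod.integral_prod_left
  have hmono := integral_mono_ae (integrable_const ((c₁ - c₀) ^ 2 / (2 * a))) hI hae
  rw [setIntegral_const, Measure.real, Real.volume_Ioo, sub_zero, ENNReal.toReal_ofReal hh.le,
    smul_eq_mul] at hmono
  rw [hFub]
  calc (c₁ - c₀) ^ 2 * h / (2 * a) = h * ((c₁ - c₀) ^ 2 / (2 * a)) := by ring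
    _ ≤ _ := hmono

end LengthArea

end Literature.Probability.RandomPlanarGeometry
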